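import Literature.IUT.LogThetaLattice.PacketLogVolumesHaarModelCapsulesGeneral
import Literature.IUT.LogVolume.TensorPacketBridge
import HarnessLib

/-!
# [IUTchIII] Proposition 3.9 (i)/(iii) for capsules at the genuine model: the BRIDGE to the Dupuy–Hilado
# recipe "probability weights × normalised log Haar measure through a decomposition" (campaign-S `weight`,
# `PacketAdm`, `packetLogμ` — the fields of the Cor. 3.12 crew's real-setting container) — proof-only

S. Mochizuki, *Inter-universal Teichmüller theory III*, kurims manuscript (May 2020), Prop. 3.9 (i) p. 115 / Remark
3.1.1 (ii)–(iv) pp. 94–97 [claim: Mochizuki2012, status: disputed]; T. Dupuy, A. Hilado, arXiv:2004.13228, Def. 3.6.1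
("the unique normalized log Haar measure `μ̄_{v⃗}` on `K_{v̲_0} ⊗ ⋯ ⊗ K_{v̲_r}`"), §3.6 (the probability weights
`Pr(v) = [F_{0,v}:ℚ_p]/[F₀:ℚ]`).

TWO ENCODINGS OF `μ^log_{A,p}` LIVE IN THE TREE: (L6) abc-iut-L6-d3's `capsulePacketLogVolume F A (prime p)`
(`PacketLogVolumesHaarModelCapsulesGeneral.lean`, p419250): portion weights `∏_α n_{v_α}/[F:ℚ]` (`portionWeight`) times
abc-iut-S7's INTRINSIC `tensorLogVolume` (Haar log-volume of `⊗_α F_{v_α}` divided by `dim_{ℚ_p}`, normalised at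
`(R_I)^∼`), on regions of positive finite Haar measure (`nonarchPortion.IsAdm`); (C312) the Cor. 3.12 crew's
real-setting container (abc-iut-c312-5 `PadicPresentation.toLocalPieces`, abc-iut-c312-1 `Real.padicPresentationPr` of
`Summits/ABC/IUTFork/Thm311RealDegree.lean`, p417577): summands `X_{v⃗} = PacketAlgebra p (K_{v_a})_a` over the SAME
rescaled completions, admissibility `PacketAdm` and log-measure `packetLogμ` of abc-iut-c312-3's `TensorPacketMeasure`
(Dupuy–Hilado's `log μ̄` through a chosen decomposition `⊗ K ≅ ∏ L_j`), weights `weightPr = ∏_a weight F v_a`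
(abc-iut-c312-3 `weight F v = n_v/[F:ℚ]`). THIS proof-only file identifies the two recipes IN L6 VOCABULARY:
* `packetVol_eq_haar_normalizedStructure`, **`packetAdm_iff_haar`** — c312-3's admissibility `PacketAdm` of a
  subset of a tensor packet IS "positive finite Haar measure" (the two Haar measures on `V`, normalised at
  `(R_I)^∼` resp. `R_I`, are proportional: abc-iut-S2 `haar_eq_smul_haar`);
* `placeProbWeight_inr_eq_weight`, `portionWeight_prime_eq_prod_weight` — the L6 portion weight at `p` IS
  `∏_α weight F v_α` (`= weightPr`);
* `nonarchPortion_isAdm_iff_packetAdm`, `nonarchPortion_logVol_eq_packetLogμ` (abc-iut `packetLogμ_eq_tensorLogVolume`,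
  `TensorPacketBridge`) — portion by portion the data coincide;
* **`capsulePacketLogVolume_prime_eq_sum_weight_packetLogμ`** — `μ^log_{A,p}(T) = Σ_π (∏_α weight F v_{π α}) ·
  log μ̄_{π}(T_π)`: the genuine `A`-packet log-volume of Prop. 3.9 at `p` IS the Dupuy–Hilado / c312 recipe on the
  same regions. Consequently the real-setting log-volume of [IUTchIII] Thm. 3.11 (i)(c) at `(j, p)` (c312-1
  `summandPiecesPr`, whose `X/adm/logμ/w` are literally these campaign-S objects over `kOf = RescaledCompletion`,
  index sets `T.Caps j ↔ A`, `T.Fibre ↔ Packet F p`) is an instance of the L6 genuine model — stated here without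
  importing `Summits/`; the index bookkeeping is the consumer's.
No new definition; nothing of c312's files is restated; nothing here bears on [IUTchIII] Cor. 3.12 or takes a side;
typed ≠ endorsed. [cite: DupuyHilado2025, Def. 3.6.1, §3.6]
-/

noncomputable section

/-! ### c312-3's admissibility is "positive finite Haar measure" -/

namespace Literature.IUT.LogVolume

open MeasureTheory Set Module
open scoped ENNReal NNReal

section Adm

variable (p : ℕ) [Fact p.Prime] {I : Type} [Fintype I] [DecidableEq I] [Nonempty I]
variable (k : I → Type) [∀ i, NontriviallyNormedField (k i)] [∀ i, NormedAlgebra ℚ_[p] (k i)]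
  [∀ i, IsUltrametricDist (k i)] [∀ i, ProperSpace (k i)]

/-- **c312-3's `packetVol` is the Haar measure normalised at `(R_I)^∼`**: `μ_{Π O_{L_j}}(ψ(A)) = μ_{(R_I)^∼}(A)` (the
chosen decomposition `ψ` carries `(R_I)^∼` onto the unit polydisc, abc-iut-c312-d1 `haar_image_equiv`).
[cite: DupuyHilado2025, Def. 3.6.1] -/
theorem packetVol_eq_haar_normalizedStructure (A : Set (PacketAlgebra p k)) :
    packetVol p k A = (normalizedStructure p k (DFac p k) (dEquiv p k)).haar A := by
  have hφ : decompositionEquiv p k (DFac p k) (dEquiv p k) ''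
      (normalizedStructure p k (DFac p k) (dEquiv p k) : Set (PacketAlgebra p k)) =
      (piUnitBallStructure (DFac p k) : Set (Π j, DFac p k j)) := by
    rw [coe_normalizedStructure, coe_piUnitBallStructure]
    exact image_normalizedPacket p k (DFac p k) (dEquiv p k)
  have h := (normalizedStructure p k (DFac p k) (dEquiv p k)).haar_image_equiv (piUnitBallStructure (DFac p k))
    (decompositionEquiv p k (DFac p k) (dEquiv p k)) hφ A
  rw [packetVol, ← h]
  rfl

/-- **`PacketAdm` is "positive finite Haar measure"** for the Haar measure normalised at `R_I` (abc-iut-S7's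
`integerStructure`): the two normalised Haar measures on `V` are proportional by the positive finite constant
`μ_{R_I}((R_I)^∼)⁻¹` (abc-iut-S2 `haar_eq_smul_haar`). [cite: DupuyHilado2025, Def. 3.5.1] -/
theorem packetAdm_iff_haar (A : Set (PacketAlgebra p k)) :
    PacketAdm p k A ↔ 0 < (integerStructure p k).haar A ∧ (integerStructure p k).haar A < ∞ := by
  set Λ := integerStructure p k
  set Λ₂ := normalizedStructure p k (DFac p k) (dEquiv p k)
  have h0 : Λ.haar (Λ₂ : Set (PacketAlgebra p k)) ≠ 0 := (Λ.haar_pos_of_isOpen Λ₂.isOpen Λ₂.nonempty).ne'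
  have ht : Λ.haar (Λ₂ : Set (PacketAlgebra p k)) ≠ ∞ := (Λ.haar_lt_top_of_isCompact Λ₂.isCompact).ne
  have hc0 : (Λ.haar (Λ₂ : Set (PacketAlgebra p k)))⁻¹ ≠ 0 := ENNReal.inv_ne_zero.mpr ht
  have hct : (Λ.haar (Λ₂ : Set (PacketAlgebra p k)))⁻¹ ≠ ∞ := ENNReal.inv_ne_top.mpr h0
  have hA : packetVol p k A = (Λ.haar (Λ₂ : Set (PacketAlgebra p k)))⁻¹ * Λ.haar A := by
    rw [packetVol_eq_haar_normalizedStructure, Λ.haar_eq_smul_haar Λ₂, Measure.smul_apply, smul_eq_mul]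
  unfold PacketAdm
  rw [hA]
  constructor
  · rintro ⟨hpos, hfin⟩
    refine ⟨pos_iff_ne_zero.mpr fun h => ?_, ?_⟩
    · rw [h, mul_zero] at hpos
      exact lt_irrefl _ hpos
    · by_contra hinf
      rw [not_lt, top_le_iff] at hinf
      rw [hinf, ENNReal.mul_top hc0] at hfin
      exact lt_irrefl _ hfin
  · rintro ⟨hpos, hfin⟩
    exact ⟨ENNReal.mul_pos hc0 hpos.ne', ENNReal.mul_lt_top hct.lt_top hfin⟩

end Adm

end Literature.IUT.LogVolume

/-! ### The `A`-packet log-volume at `p` is the weighted sum of Dupuy–Hilado log-measures -/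

namespace Literature.IUT.LogThetaLattice

open Literature.IUT.LogVolume Literature.NumberTheory.NumberFields NumberField IsDedekindDomain MeasureTheory Set
open scoped ENNReal NNReal

variable (F : Type) [Field F] [NumberField F]
variable (A : Type) [Fintype A] [DecidableEq A] [Nonempty A]

/-- The L6 weight of a finite place IS c312-3's probability weight `weight F v = n_v/[F:ℚ]` (Dupuy–Hilado §3.6
`Pr(v)`). [cite: DupuyHilado2025, §3.6] -/
theorem placeProbWeight_inr_eq_weight (v : HeightOneSpectrum (𝓞 F)) :
    placeProbWeight F (Sum.inr v) = weight F v := rfl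

omit [DecidableEq A] [Nonempty A] in
/-- **The portion weight at `p` IS `∏_α Pr(v_α)`** (c312-1's `weightPr`). [cite: DupuyHilado2025, §3.6] -/
theorem portionWeight_prime_eq_prod_weight (p : Nat.Primes) (π : Portion F A (RatPlace.prime p)) :
    portionWeight F A (RatPlace.prime p) π = ∏ α, weight F (packetPrimeEquiv F p (π α)).1 := by
  unfold portionWeight
  refine Finset.prod_congr rfl fun α _ => ?_
  generalize π α = v
  rcases v with ⟨w | w, h⟩
  · exact absurd h (ratPlaceBelow_inl_ne_prime F w p)
  · rfl

section Prime

variable (p : Nat.Primes) [Fact (p : ℕ).Prime] (vA : A → {v : HeightOneSpectrum (𝓞 F) // v ∈ placesOver F (p : ℕ)})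

/-- **Admissibility of a region of the portion `⊗_α F_{v_α}` in L6's sense IS c312-3's `PacketAdm`.**
[cite: DupuyHilado2025, Def. 3.5.1] -/
theorem nonarchPortion_isAdm_iff_packetAdm (T : Set (nonarchPortion F A p vA).X) :
    (nonarchPortion F A p vA).IsAdm T ↔ PacketAdm p (fun α => Kp F p (vA α)) T :=
  (packetAdm_iff_haar p (fun α => Kp F p (vA α)) T).symm

/-- **The portion log-volume IS Dupuy–Hilado's `log μ̄`** on admissible regions: `tensorLogVolume = packetLogμ`
(abc-iut `packetLogμ_eq_tensorLogVolume`). [cite: DupuyHilado2025, Def. 3.6.1] -/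
theorem nonarchPortion_logVol_eq_packetLogμ {T : Set (nonarchPortion F A p vA).X} (hT : (nonarchPortion F A p vA).IsAdm T) :
    (nonarchPortion F A p vA).logVol T = packetLogμ p (fun α => Kp F p (vA α)) T :=
  (packetLogμ_eq_tensorLogVolume p (fun α => Kp F p (vA α)) hT.1 hT.2).symm

end Prime

/-- **[IUTchIII] Prop. 3.9's `μ^log_{A,p}` at the genuine model IS the Dupuy–Hilado / Cor. 3.12-crew recipe**: for
every region `T = (T_π)_π` of the `A`-packet at `p`,
`capsulePacketLogVolume F A p T = Σ_π (∏_α weight F v_{π α}) · packetLogμ_π(T_π)` — probability weights times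
the normalised log Haar measure through a decomposition, summand by summand (the fields `w`, `logμ` of abc-iut-c312-1's
`Real.padicPresentationPr` over the same rescaled completions). [cite: DupuyHilado2025, Def. 3.6.1, §3.6] -/
theorem capsulePacketLogVolume_prime_eq_sum_weight_packetLogμ (p : Nat.Primes)
    (T : ∀ π : Portion F A (RatPlace.prime p), (portionDatum F A (RatPlace.prime p) π).Adm) :
    capsulePacketLogVolume F A (RatPlace.prime p) T =
      ∑ π : Portion F A (RatPlace.prime p), (∏ α, weight F (packetPrimeEquiv F p (π α)).1) *
        (haveI : Fact (p : ℕ).Prime := ⟨p.2⟩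
         packetLogμ p (fun α => Kp F p (packetPrimeEquiv F p (π α))) (T π).1) := by
  haveI : Fact (p : ℕ).Prime := ⟨p.2⟩
  unfold capsulePacketLogVolume
  refine Finset.sum_congr rfl fun π _ => ?_
  rw [portionWeight_prime_eq_prod_weight]
  congr 1
  exact nonarchPortion_logVol_eq_packetLogμ F A p (fun α => packetPrimeEquiv F p (π α)) (T π).2

/-- The same identity for the admissibility predicates: a family `T` of subsets of the portions at `p` is a region
of the `A`-packet in L6's sense iff every `T_π` is `PacketAdm` (c312's sense). [cite: DupuyHilado2025, Def. 3.5.1] -/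
theorem portionDatum_prime_isAdm_iff_packetAdm (p : Nat.Primes) (π : Portion F A (RatPlace.prime p))
    (T : Set (portionDatum F A (RatPlace.prime p) π).X) :
    (portionDatum F A (RatPlace.prime p) π).IsAdm T ↔
      (haveI : Fact (p : ℕ).Prime := ⟨p.2⟩
       PacketAdm p (fun α => Kp F p (packetPrimeEquiv F p (π α))) T) := by
  haveI : Fact (p : ℕ).Prime := ⟨p.2⟩
  exact nonarchPortion_isAdm_iff_packetAdm F A p (fun α => packetPrimeEquiv F p (π α)) T

end Literature.IUT.LogThetaLattice

end
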